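import Summits.FinalStateConjecture.FinalStateConjecture.Theorems.SwallowTheDatumKerrShieldedDataExistBridgeRadial
import Literature.Geometry.Lorentzian.KerrStarCoord
import HarnessLib

/-!
# `KerrShieldedDataExist`, line `plug-the-second-sheet` (skeleton v4 "KerrCap") — stub `stub_capImmersion`, II:
# the cap map `X(u) = L_{ϱ(s)} Rot_z(α(s)) (u/s)` — radius identity, smoothness, differential

Support file (`--supports stmt-FinalStateConjecture-10055`; everything proved, no definitions, no named facts)
for the registered stub `stub_capImmersion` of `Cruxes/KerrShieldedDataExist/Lines/plug_the_second_sheet.lean`.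
The spatial part of the cap map is, for profiles `ϱ, α : ℝ → ℝ` of `s = ‖u‖`,
`X u = L_{ϱ(s)} (Rot_z(α(s)) (u/s))`, `L_r n = r n + a ẑ × n` (Kerr's spheroidal point `Y_a(r, n)`), i.e. in
components, with `c = cos α(s)`, `S = sin α(s)`, `P = c u₀ − S u₁`, `Q = S u₀ + c u₁`,
`X u = ((ϱP − aQ)/s, (ϱQ + aP)/s, ϱu₂/s)`. Here `X` is an arbitrary function satisfying this equation
(hypothesis-with-equation, exactly as in the stub; no definition is introduced). Contents:

* `norm_sq_capMap`: `‖X u‖² = ϱ² + a² − a²u₂²/s²`; **`radius_capMap`: `r(t, X u) = ϱ(s)`** for `u ≠ 0`,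
  `ϱ(s) > 0` — `X u` solves the defining quartic of the Kerr–Schild radius with the positive root `ϱ(s)`
  (`Kerr.radius_eq_of_pos_of_quartic`; `L_r` maps the unit sphere onto the confocal ellipsoid `{r = r}`);
* `contDiffAt_capMap`: `X` is `C^∞` off the origin (for `C^∞` profiles);
* `fderiv_capMap_apply`: the differential `DX(u) v` in closed form (chain rule through `s = ‖u‖`);
  `eq_zero_of_fderiv_capMap_eq_zero`: for `v ⊥ u`, `DX(u) v = (1/s) L_ϱ Rot_z(α) v = 0` forces `v = 0`
  (`L_r`, `r > 0`, and rotations are injective);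
* `radiusGrad_fderiv_capMap`: **`dr(DX(u) v) = ϱ′(s) ⟪u, v⟫/s`** (differentiate `r ∘ X = ϱ ∘ ‖·‖`);
* `contDiffAt_capImm`, `hasFDerivAt_capImm`, `fderiv_capImm_apply`: the full cap map
  `Φ(u) = (τ(s), X u)` into the ingoing Kerr–Schild chart is `C^∞` off the origin with
  `DΦ(u) v = (τ′(s)⟪u, v⟫/s, DX(u) v)`.

References: Visser arXiv:0706.0622, §4 and (32)–(35) (Kerr's spheroidal coordinates, the quartic of `r`);
Dafermos–Rodnianski arXiv:0811.0354, §5.1; O'Neill 1983, Ch. 4.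
-/

-- the doubled `FinalStateConjecture` path component is the summit/problem naming scheme, not a mistake
set_option linter.dupNamespace false

noncomputable section

open Real Set Filter
open scoped Manifold ContDiff Topology InnerProductSpace
open Literature.Geometry.Lorentzian

namespace Summit.FinalStateConjecture.FinalStateConjecture.Theorems.SwallowTheDatum

namespace KerrCap

section CapMap

variable {ϱ α : ℝ → ℝ} {a : ℝ} {X : E3 → E3}
  (hX : ∀ u : E3, X u =
    !₂[(ϱ ‖u‖ * (Real.cos (α ‖u‖) * u 0 - Real.sin (α ‖u‖) * u 1) -
          a * (Real.sin (α ‖u‖) * u 0 + Real.cos (α ‖u‖) * u 1)) / ‖u‖,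
       (ϱ ‖u‖ * (Real.sin (α ‖u‖) * u 0 + Real.cos (α ‖u‖) * u 1) +
          a * (Real.cos (α ‖u‖) * u 0 - Real.sin (α ‖u‖) * u 1)) / ‖u‖,
       ϱ ‖u‖ * u 2 / ‖u‖])

include hX

/-! ### Components, norm, Kerr–Schild radius -/

/-- First component of the cap map: `(ϱP − aQ)/s`. [folklore] -/
theorem capMap_apply_zero (u : E3) :
    X u 0 = (ϱ ‖u‖ * (Real.cos (α ‖u‖) * u 0 - Real.sin (α ‖u‖) * u 1) -
      a * (Real.sin (α ‖u‖) * u 0 + Real.cos (α ‖u‖) * u 1)) / ‖u‖ := by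
  rw [hX u]; rfl

/-- Second component of the cap map: `(ϱQ + aP)/s`. [folklore] -/
theorem capMap_apply_one (u : E3) :
    X u 1 = (ϱ ‖u‖ * (Real.sin (α ‖u‖) * u 0 + Real.cos (α ‖u‖) * u 1) +
      a * (Real.cos (α ‖u‖) * u 0 - Real.sin (α ‖u‖) * u 1)) / ‖u‖ := by
  rw [hX u]; rfl

/-- Third component of the cap map: `ϱu₂/s`. [folklore] -/
theorem capMap_apply_two (u : E3) : X u 2 = ϱ ‖u‖ * u 2 / ‖u‖ := by
  rw [hX u]; rfl

/-- **`‖X u‖² = ϱ(s)² + a² − a² u₂²/s²`** (`u ≠ 0`): `|L_r n|² = r² + a²(1 − n₂²)` on unit vectors, rotations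
about `ẑ` preserve `n₂` and the norm. Visser arXiv:0706.0622, §4 (`‖Y_a(r,θ,φ)‖² = r² + a² sin²θ`). [cite: arXiv07060622, §4] -/
theorem norm_sq_capMap {u : E3} (hu : u ≠ 0) :
    ‖X u‖ ^ 2 = ϱ ‖u‖ ^ 2 + a ^ 2 - a ^ 2 * u 2 ^ 2 / ‖u‖ ^ 2 := by
  have hs0 : ‖u‖ ≠ 0 := norm_ne_zero_iff.2 hu
  have hcs := Real.sin_sq_add_cos_sq (α ‖u‖)
  have h1 : ‖X u‖ ^ 2 = ((ϱ ‖u‖ ^ 2 + a ^ 2) * (u 0 ^ 2 + u 1 ^ 2) *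
      (Real.sin (α ‖u‖) ^ 2 + Real.cos (α ‖u‖) ^ 2) + ϱ ‖u‖ ^ 2 * u 2 ^ 2) / ‖u‖ ^ 2 := by
    rw [E3.norm_sq, capMap_apply_zero hX, capMap_apply_one hX, capMap_apply_two hX]
    field_simp
    ring
  have h2 : u 0 ^ 2 + u 1 ^ 2 = ‖u‖ ^ 2 - u 2 ^ 2 := by rw [E3.norm_sq]; ring
  rw [h1, hcs, mul_one, h2]
  field_simp
  ring

/-- **The Kerr–Schild radius of the cap map is the profile: `r(t, X u) = ϱ(s)`** (`u ≠ 0`, `ϱ(s) > 0`): with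
`‖X u‖² − a² = ϱ² − a²u₂²/s²` and `(X u)₂ = ϱu₂/s`, `X u` solves the defining quartic
`ρ⁴ − (‖x⃗‖² − a²)ρ² − a²z² = 0` of `Kerr.radius` with the positive root `ρ = ϱ(s)`
(`Kerr.radius_eq_of_pos_of_quartic`; equivalently `X u = Y_a(ϱ(s), n)` lies on the confocal ellipsoid
`{r = ϱ(s)}`, `Kerr.radius_kerrStar`). [cite: arXiv07060622, §4 and (35)] -/
theorem radius_capMap {u : E3} (hu : u ≠ 0) (hϱu : 0 < ϱ ‖u‖) (t : ℝ) :
    Kerr.radius a (E4.ofTimeSpace t (X u)) = ϱ ‖u‖ := by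
  have hs0 : ‖u‖ ≠ 0 := norm_ne_zero_iff.2 hu
  apply Kerr.radius_eq_of_pos_of_quartic hϱu
  rw [E4.spatialNorm_ofTimeSpace, show E4.ofTimeSpace t (X u) 3 = X u 2 from E4.ofTimeSpace_apply_succ t _ 2,
    norm_sq_capMap hX hu, capMap_apply_two hX]
  field_simp
  ring

/-! ### Smoothness off the origin -/

/-- **The cap map is `C^∞` off the origin** (`‖·‖` is smooth off `0`; `ϱ, α, cos, sin` are smooth).
[folklore] -/
theorem contDiffAt_capMap (hϱ : ContDiff ℝ ∞ ϱ) (hα : ContDiff ℝ ∞ α) {u : E3} (hu : u ≠ 0) :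
    ContDiffAt ℝ ∞ X u := by
  have hXf : X = fun u ↦
      !₂[(ϱ ‖u‖ * (Real.cos (α ‖u‖) * u 0 - Real.sin (α ‖u‖) * u 1) -
            a * (Real.sin (α ‖u‖) * u 0 + Real.cos (α ‖u‖) * u 1)) / ‖u‖,
         (ϱ ‖u‖ * (Real.sin (α ‖u‖) * u 0 + Real.cos (α ‖u‖) * u 1) +
            a * (Real.cos (α ‖u‖) * u 0 - Real.sin (α ‖u‖) * u 1)) / ‖u‖,
         ϱ ‖u‖ * u 2 / ‖u‖] := funext hX
  have hs0 : ‖u‖ ≠ 0 := norm_ne_zero_iff.2 hu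
  have hn : ContDiffAt ℝ ∞ (fun u : E3 ↦ ‖u‖) u := contDiffAt_norm ℝ hu
  have hϱn : ContDiffAt ℝ ∞ (fun u : E3 ↦ ϱ ‖u‖) u := hϱ.contDiffAt.comp u hn
  have hαn : ContDiffAt ℝ ∞ (fun u : E3 ↦ α ‖u‖) u := hα.contDiffAt.comp u hn
  have hc : ContDiffAt ℝ ∞ (fun u : E3 ↦ Real.cos (α ‖u‖)) u := Real.contDiff_cos.contDiffAt.comp u hαn
  have hs : ContDiffAt ℝ ∞ (fun u : E3 ↦ Real.sin (α ‖u‖)) u := Real.contDiff_sin.contDiffAt.comp u hαn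
  have hπ : ∀ i : Fin 3, ContDiffAt ℝ ∞ (fun u : E3 ↦ u i) u := fun i ↦
    contDiffAt_piLp_apply (𝕜 := ℝ) 2 (i := i)
  have hP : ContDiffAt ℝ ∞ (fun u : E3 ↦ Real.cos (α ‖u‖) * u 0 - Real.sin (α ‖u‖) * u 1) u :=
    (hc.mul (hπ 0)).sub (hs.mul (hπ 1))
  have hQ : ContDiffAt ℝ ∞ (fun u : E3 ↦ Real.sin (α ‖u‖) * u 0 + Real.cos (α ‖u‖) * u 1) u :=
    (hs.mul (hπ 0)).add (hc.mul (hπ 1))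
  rw [hXf, contDiffAt_euclidean]
  intro i
  fin_cases i
  · exact ((hϱn.mul hP).sub (contDiffAt_const.mul hQ)).div hn hs0
  · exact ((hϱn.mul hQ).add (contDiffAt_const.mul hP)).div hn hs0
  · exact (hϱn.mul (hπ 2)).div hn hs0

/-- The cap map is differentiable off the origin. [folklore] -/
theorem differentiableAt_capMap (hϱ : ContDiff ℝ ∞ ϱ) (hα : ContDiff ℝ ∞ α) {u : E3} (hu : u ≠ 0) :
    DifferentiableAt ℝ X u :=
  (contDiffAt_capMap hX hϱ hα hu).differentiableAt (by simp)

/-! ### The differential `DX(u) v` -/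

/-- **The differential of the cap map**, componentwise, at `u ≠ 0`: with `c = cos α(s)`, `S = sin α(s)`,
`P = cu₀ − Su₁`, `Q = Su₀ + cu₁`, `P_v = cv₀ − Sv₁`, `Q_v = Sv₀ + cv₁`,
`DX(u)v = ((ϱP_v − aQ_v)/s, (ϱQ_v + aP_v)/s, ϱv₂/s) + ⟪u,v⟫ · (radial terms)`, the radial terms being
`((ϱ′P − α′(ϱQ + aP))/s² − (ϱP − aQ)/s³, (ϱ′Q + α′(ϱP − aQ))/s² − (ϱQ + aP)/s³, ϱ′u₂/s² − ϱu₂/s³)`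
(chain rule through `s = ‖u‖`, `ds = ⟪u, ·⟫/s`). [folklore] -/
theorem fderiv_capMap_apply (hϱ : ContDiff ℝ ∞ ϱ) (hα : ContDiff ℝ ∞ α) {u : E3} (hu : u ≠ 0) (v : E3) :
    fderiv ℝ X u v 0 =
        (ϱ ‖u‖ * (Real.cos (α ‖u‖) * v 0 - Real.sin (α ‖u‖) * v 1) -
            a * (Real.sin (α ‖u‖) * v 0 + Real.cos (α ‖u‖) * v 1)) / ‖u‖ +
          ⟪u, v⟫_ℝ * ((deriv ϱ ‖u‖ * (Real.cos (α ‖u‖) * u 0 - Real.sin (α ‖u‖) * u 1) -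
              deriv α ‖u‖ * (ϱ ‖u‖ * (Real.sin (α ‖u‖) * u 0 + Real.cos (α ‖u‖) * u 1) +
                a * (Real.cos (α ‖u‖) * u 0 - Real.sin (α ‖u‖) * u 1))) / ‖u‖ ^ 2 -
            (ϱ ‖u‖ * (Real.cos (α ‖u‖) * u 0 - Real.sin (α ‖u‖) * u 1) -
              a * (Real.sin (α ‖u‖) * u 0 + Real.cos (α ‖u‖) * u 1)) / ‖u‖ ^ 3) ∧
      fderiv ℝ X u v 1 =
        (ϱ ‖u‖ * (Real.sin (α ‖u‖) * v 0 + Real.cos (α ‖u‖) * v 1) +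
            a * (Real.cos (α ‖u‖) * v 0 - Real.sin (α ‖u‖) * v 1)) / ‖u‖ +
          ⟪u, v⟫_ℝ * ((deriv ϱ ‖u‖ * (Real.sin (α ‖u‖) * u 0 + Real.cos (α ‖u‖) * u 1) +
              deriv α ‖u‖ * (ϱ ‖u‖ * (Real.cos (α ‖u‖) * u 0 - Real.sin (α ‖u‖) * u 1) -
                a * (Real.sin (α ‖u‖) * u 0 + Real.cos (α ‖u‖) * u 1))) / ‖u‖ ^ 2 -
            (ϱ ‖u‖ * (Real.sin (α ‖u‖) * u 0 + Real.cos (α ‖u‖) * u 1) +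
              a * (Real.cos (α ‖u‖) * u 0 - Real.sin (α ‖u‖) * u 1)) / ‖u‖ ^ 3) ∧
      fderiv ℝ X u v 2 =
        ϱ ‖u‖ * v 2 / ‖u‖ + ⟪u, v⟫_ℝ * (deriv ϱ ‖u‖ * u 2 / ‖u‖ ^ 2 - ϱ ‖u‖ * u 2 / ‖u‖ ^ 3) := by
  have hs0 : ‖u‖ ≠ 0 := norm_ne_zero_iff.2 hu
  have hdϱ : HasDerivAt ϱ (deriv ϱ ‖u‖) ‖u‖ := (hϱ.differentiable (by simp)).differentiableAt.hasDerivAt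
  have hdα : HasDerivAt α (deriv α ‖u‖) ‖u‖ := (hα.differentiable (by simp)).differentiableAt.hasDerivAt
  have hnorm : HasFDerivAt (fun u : E3 ↦ ‖u‖) (‖u‖⁻¹ • E3.covec u) u := Kerr.hasFDerivAt_norm_E3 hu
  have hϱ' : HasFDerivAt (fun u : E3 ↦ ϱ ‖u‖) ((deriv ϱ ‖u‖ * ‖u‖⁻¹) • E3.covec u) u :=
    Bridge.hasFDerivAt_comp_norm hu hdϱ
  have hα' : HasFDerivAt (fun u : E3 ↦ α ‖u‖) ((deriv α ‖u‖ * ‖u‖⁻¹) • E3.covec u) u :=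
    Bridge.hasFDerivAt_comp_norm hu hdα
  have hcos : HasFDerivAt (Real.cos ∘ fun u : E3 ↦ α ‖u‖)
      (-Real.sin (α ‖u‖) • ((deriv α ‖u‖ * ‖u‖⁻¹) • E3.covec u)) u :=
    (Real.hasDerivAt_cos (α ‖u‖)).comp_hasFDerivAt u hα'
  have hsin : HasFDerivAt (Real.sin ∘ fun u : E3 ↦ α ‖u‖)
      (Real.cos (α ‖u‖) • ((deriv α ‖u‖ * ‖u‖⁻¹) • E3.covec u)) u :=
    (Real.hasDerivAt_sin (α ‖u‖)).comp_hasFDerivAt u hα'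
  have hπ : ∀ i : Fin 3, HasFDerivAt (fun u : E3 ↦ u i) (EuclideanSpace.proj i : E3 →L[ℝ] ℝ) u := fun i ↦
    (EuclideanSpace.proj (𝕜 := ℝ) i).hasFDerivAt
  have hinv : HasFDerivAt (fun u : E3 ↦ ‖u‖⁻¹) (-(‖u‖ ^ 2)⁻¹ • (‖u‖⁻¹ • E3.covec u)) u :=
    (hasDerivAt_inv hs0).comp_hasFDerivAt u hnorm
  have hP : HasFDerivAt (fun u : E3 ↦ Real.cos (α ‖u‖) * u 0 - Real.sin (α ‖u‖) * u 1) _ u :=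
    (hcos.mul (hπ 0)).sub (hsin.mul (hπ 1))
  have hQ : HasFDerivAt (fun u : E3 ↦ Real.sin (α ‖u‖) * u 0 + Real.cos (α ‖u‖) * u 1) _ u :=
    (hsin.mul (hπ 0)).add (hcos.mul (hπ 1))
  have h0 : HasFDerivAt (fun u : E3 ↦ (ϱ ‖u‖ * (Real.cos (α ‖u‖) * u 0 - Real.sin (α ‖u‖) * u 1) -
      a * (Real.sin (α ‖u‖) * u 0 + Real.cos (α ‖u‖) * u 1)) * ‖u‖⁻¹) _ u :=
    ((hϱ'.mul hP).sub (hQ.const_mul a)).mul hinv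
  have h1 : HasFDerivAt (fun u : E3 ↦ (ϱ ‖u‖ * (Real.sin (α ‖u‖) * u 0 + Real.cos (α ‖u‖) * u 1) +
      a * (Real.cos (α ‖u‖) * u 0 - Real.sin (α ‖u‖) * u 1)) * ‖u‖⁻¹) _ u :=
    ((hϱ'.mul hQ).add (hP.const_mul a)).mul hinv
  have h2 : HasFDerivAt (fun u : E3 ↦ (ϱ ‖u‖ * u 2) * ‖u‖⁻¹) _ u := (hϱ'.mul (hπ 2)).mul hinv
  -- the components of `DX(u)` are the differentials of the components
  have hXd : HasFDerivAt X (fderiv ℝ X u) u := (differentiableAt_capMap hX hϱ hα hu).hasFDerivAt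
  have hc : ∀ i : Fin 3, HasFDerivAt (fun u : E3 ↦ X u i)
      ((EuclideanSpace.proj i : E3 →L[ℝ] ℝ).comp (fderiv ℝ X u)) u := fun i ↦
    (EuclideanSpace.proj (𝕜 := ℝ) i).hasFDerivAt.comp u hXd
  have e0 : (fun u : E3 ↦ X u 0) = fun u : E3 ↦ (ϱ ‖u‖ * (Real.cos (α ‖u‖) * u 0 - Real.sin (α ‖u‖) * u 1) -
      a * (Real.sin (α ‖u‖) * u 0 + Real.cos (α ‖u‖) * u 1)) * ‖u‖⁻¹ := by
    funext w; rw [capMap_apply_zero hX, div_eq_mul_inv]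
  have e1 : (fun u : E3 ↦ X u 1) = fun u : E3 ↦ (ϱ ‖u‖ * (Real.sin (α ‖u‖) * u 0 + Real.cos (α ‖u‖) * u 1) +
      a * (Real.cos (α ‖u‖) * u 0 - Real.sin (α ‖u‖) * u 1)) * ‖u‖⁻¹ := by
    funext w; rw [capMap_apply_one hX, div_eq_mul_inv]
  have e2 : (fun u : E3 ↦ X u 2) = fun u : E3 ↦ (ϱ ‖u‖ * u 2) * ‖u‖⁻¹ := by
    funext w; rw [capMap_apply_two hX, div_eq_mul_inv]
  have k0 := hc 0
  have k1 := hc 1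
  have k2 := hc 2
  rw [e0] at k0
  rw [e1] at k1
  rw [e2] at k2
  have j0 := congrArg (fun L : E3 →L[ℝ] ℝ ↦ L v) (k0.unique h0)
  have j1 := congrArg (fun L : E3 →L[ℝ] ℝ ↦ L v) (k1.unique h1)
  have j2 := congrArg (fun L : E3 →L[ℝ] ℝ ↦ L v) (k2.unique h2)
  simp only [ContinuousLinearMap.comp_apply, _root_.add_apply, _root_.sub_apply, FunLike.coe_smul,
    Pi.smul_apply, E3.covec_apply, smul_eq_mul, PiLp.proj_apply, Pi.sub_apply, Pi.add_apply, Pi.mul_apply,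
    Function.comp_apply] at j0 j1 j2
  refine ⟨?_, ?_, ?_⟩
  · rw [j0]; field_simp; ring
  · rw [j1]; field_simp; ring
  · rw [j2]; field_simp; ring

/-- **For `v ⊥ u`, `DX(u) v = (1/s) L_{ϱ(s)} Rot_z(α(s)) v` vanishes only for `v = 0`** (`ϱ(s) > 0`): from
`ϱP_v − aQ_v = 0 = ϱQ_v + aP_v` one gets `(ϱ² + a²)P_v = (ϱ² + a²)Q_v = 0`, and `(v₀, v₁)` is the rotation of
`(P_v, Q_v)`; `ϱv₂ = 0`. [folklore] -/
theorem eq_zero_of_fderiv_capMap_eq_zero (hϱ : ContDiff ℝ ∞ ϱ) (hα : ContDiff ℝ ∞ α) {u : E3} (hu : u ≠ 0)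
    (hϱu : 0 < ϱ ‖u‖) {v : E3} (huv : ⟪u, v⟫_ℝ = 0) (hv : fderiv ℝ X u v = 0) : v = 0 := by
  have hs0 : ‖u‖ ≠ 0 := norm_ne_zero_iff.2 hu
  obtain ⟨h0, h1, h2⟩ := fderiv_capMap_apply hX hϱ hα hu v
  rw [hv, huv] at h0 h1 h2
  simp only [PiLp.zero_apply, zero_mul, add_zero] at h0 h1 h2
  set c := Real.cos (α ‖u‖) with hc
  set S := Real.sin (α ‖u‖) with hS
  have hcs : S ^ 2 + c ^ 2 = 1 := Real.sin_sq_add_cos_sq (α ‖u‖)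
  set ρ := ϱ ‖u‖ with hρ
  have hP : ρ * (c * v 0 - S * v 1) - a * (S * v 0 + c * v 1) = 0 := by
    have := h0.symm
    rw [div_eq_zero_iff] at this
    exact this.resolve_right hs0
  have hQ : ρ * (S * v 0 + c * v 1) + a * (c * v 0 - S * v 1) = 0 := by
    have := h1.symm
    rw [div_eq_zero_iff] at this
    exact this.resolve_right hs0
  have h2' : ρ * v 2 = 0 := by
    have := h2.symm
    rw [div_eq_zero_iff] at this
    exact this.resolve_right hs0
  have hρa : 0 < ρ ^ 2 + a ^ 2 := by positivity
  have hPv : c * v 0 - S * v 1 = 0 := by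
    have : (ρ ^ 2 + a ^ 2) * (c * v 0 - S * v 1) = 0 := by linear_combination ρ * hP + a * hQ
    exact (mul_eq_zero.1 this).resolve_left hρa.ne'
  have hQv : S * v 0 + c * v 1 = 0 := by
    have : (ρ ^ 2 + a ^ 2) * (S * v 0 + c * v 1) = 0 := by linear_combination ρ * hQ - a * hP
    exact (mul_eq_zero.1 this).resolve_left hρa.ne'
  have hv0 : v 0 = 0 := by linear_combination c * hPv + S * hQv - v 0 * hcs
  have hv1 : v 1 = 0 := by linear_combination -S * hPv + c * hQv - v 1 * hcs
  have hv2 : v 2 = 0 := (mul_eq_zero.1 h2').resolve_left hϱu.ne'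
  ext i
  fin_cases i
  · exact hv0
  · exact hv1
  · exact hv2

/-- **`dr(DX(u) v) = ϱ′(s)⟪u, v⟫/s`**: the Kerr–Schild radius of the cap map is `r ∘ X = ϱ ∘ ‖·‖` near every
`u ≠ 0` (`radius_capMap`, `ϱ > 0`), so by the chain rule (`Kerr.hasFDerivAt_radius_slice`) the radial covector
`dr` at `X u` evaluates on `DX(u) v` to the derivative of `ϱ(‖·‖)`. [folklore] -/
theorem radiusGrad_fderiv_capMap (hϱ : ContDiff ℝ ∞ ϱ) (hα : ContDiff ℝ ∞ α) (hϱ0 : ∀ s, 0 < ϱ s) {u : E3}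
    (hu : u ≠ 0) (v : E3) :
    Kerr.radiusGrad a (X u) (fderiv ℝ X u v) = deriv ϱ ‖u‖ * ‖u‖⁻¹ * ⟪u, v⟫_ℝ := by
  have hdϱ : HasDerivAt ϱ (deriv ϱ ‖u‖) ‖u‖ := (hϱ.differentiable (by simp)).differentiableAt.hasDerivAt
  have hr : 0 < Kerr.radius a (E4.ofTimeSpace 0 (X u)) := by
    rw [radius_capMap hX hu (hϱ0 _) 0]; exact hϱ0 _
  have h1 : HasFDerivAt (fun u : E3 ↦ Kerr.radius a (E4.ofTimeSpace 0 (X u)))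
      ((Kerr.radiusGrad a (X u)).comp (fderiv ℝ X u)) u :=
    (Kerr.hasFDerivAt_radius_slice hr).comp u (differentiableAt_capMap hX hϱ hα hu).hasFDerivAt
  have hev : (fun u : E3 ↦ Kerr.radius a (E4.ofTimeSpace 0 (X u))) =ᶠ[𝓝 u] fun u : E3 ↦ ϱ ‖u‖ := by
    filter_upwards [isOpen_compl_singleton.mem_nhds hu] with w hw
    exact radius_capMap hX hw (hϱ0 _) 0
  have h2 : HasFDerivAt (fun u : E3 ↦ Kerr.radius a (E4.ofTimeSpace 0 (X u)))
      ((deriv ϱ ‖u‖ * ‖u‖⁻¹) • E3.covec u) u :=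
    (Bridge.hasFDerivAt_comp_norm hu hdϱ).congr_of_eventuallyEq hev
  have := congrArg (fun L : E3 →L[ℝ] ℝ ↦ L v) (h1.unique h2)
  simpa only [ContinuousLinearMap.comp_apply, FunLike.coe_smul, Pi.smul_apply, E3.covec_apply,
    smul_eq_mul] using this

/-! ### The full cap map `Φ(u) = (τ(s), X u)` -/

/-- **The cap map `Φ(u) = (τ(‖u‖), X u)` into the Kerr–Schild chart is `C^∞` off the origin.** [folklore] -/
theorem contDiffAt_capImm {τ : ℝ → ℝ} (hτ : ContDiff ℝ ∞ τ) (hϱ : ContDiff ℝ ∞ ϱ) (hα : ContDiff ℝ ∞ α)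
    {u : E3} (hu : u ≠ 0) : ContDiffAt ℝ ∞ (fun u : E3 ↦ E4.ofTimeSpace (τ ‖u‖) (X u)) u := by
  have hfun : (fun u : E3 ↦ E4.ofTimeSpace (τ ‖u‖) (X u)) =
      fun u ↦ τ ‖u‖ • E4.basisVector 0 + E4.spaceEmbed (X u) :=
    funext fun u ↦ E4.ofTimeSpace_eq_smul_add' _ _
  rw [hfun]
  have hn : ContDiffAt ℝ ∞ (fun u : E3 ↦ ‖u‖) u := contDiffAt_norm ℝ hu
  exact ((hτ.contDiffAt.comp u hn).smul contDiffAt_const).add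
    (E4.spaceEmbed.contDiff.contDiffAt.comp u (contDiffAt_capMap hX hϱ hα hu))

/-- **The differential of the cap map**: `DΦ(u) = (τ′(s)/s)⟪u, ·⟫ ∂_{t*} + (0, DX(u) ·)`. [folklore] -/
theorem hasFDerivAt_capImm {τ : ℝ → ℝ} (hτ : ContDiff ℝ ∞ τ) (hϱ : ContDiff ℝ ∞ ϱ) (hα : ContDiff ℝ ∞ α)
    {u : E3} (hu : u ≠ 0) :
    HasFDerivAt (fun u : E3 ↦ E4.ofTimeSpace (τ ‖u‖) (X u))
      (((deriv τ ‖u‖ * ‖u‖⁻¹) • E3.covec u).smulRight (E4.basisVector 0) +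
        E4.spaceEmbed.comp (fderiv ℝ X u)) u := by
  have hfun : (fun u : E3 ↦ E4.ofTimeSpace (τ ‖u‖) (X u)) =
      fun u ↦ τ ‖u‖ • E4.basisVector 0 + E4.spaceEmbed (X u) :=
    funext fun u ↦ E4.ofTimeSpace_eq_smul_add' _ _
  rw [hfun]
  have hdτ : HasDerivAt τ (deriv τ ‖u‖) ‖u‖ := (hτ.differentiable (by simp)).differentiableAt.hasDerivAt
  exact ((Bridge.hasFDerivAt_comp_norm hu hdτ).smul_const (E4.basisVector 0)).add
    (E4.spaceEmbed.hasFDerivAt.comp u (differentiableAt_capMap hX hϱ hα hu).hasFDerivAt)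

/-- **`DΦ(u) v = (τ′(s)⟪u, v⟫/s, DX(u) v)`.** [folklore] -/
theorem fderiv_capImm_apply {τ : ℝ → ℝ} (hτ : ContDiff ℝ ∞ τ) (hϱ : ContDiff ℝ ∞ ϱ) (hα : ContDiff ℝ ∞ α)
    {u : E3} (hu : u ≠ 0) (v : E3) :
    fderiv ℝ (fun u : E3 ↦ E4.ofTimeSpace (τ ‖u‖) (X u)) u v =
      E4.ofTimeSpace (deriv τ ‖u‖ * ‖u‖⁻¹ * ⟪u, v⟫_ℝ) (fderiv ℝ X u v) := by
  rw [(hasFDerivAt_capImm hX hτ hϱ hα hu).fderiv, E4.ofTimeSpace_eq_smul_add']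
  simp only [_root_.add_apply, ContinuousLinearMap.smulRight_apply, FunLike.coe_smul, Pi.smul_apply,
    E3.covec_apply, smul_eq_mul, ContinuousLinearMap.comp_apply]

/-- The cap map is differentiable off the origin. [folklore] -/
theorem differentiableAt_capImm {τ : ℝ → ℝ} (hτ : ContDiff ℝ ∞ τ) (hϱ : ContDiff ℝ ∞ ϱ)
    (hα : ContDiff ℝ ∞ α) {u : E3} (hu : u ≠ 0) :
    DifferentiableAt ℝ (fun u : E3 ↦ E4.ofTimeSpace (τ ‖u‖) (X u)) u :=
  (hasFDerivAt_capImm hX hτ hϱ hα hu).differentiableAt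

end CapMap

end KerrCap

/-- **Registered export of this file** (sub-goal `cap_mapRadius` of stub `stub_capImmersion`): the Kerr–Schild
radius of the cap map is the profile, `KerrCap.radius_capMap`. [cite: arXiv07060622, §4 and (35)] -/
theorem cap_mapRadius :
    ∀ {ϱ α : ℝ → ℝ} {a : ℝ} {X : E3 → E3}, (∀ u : E3, X u = !₂[(ϱ ‖u‖ * (Real.cos (α ‖u‖) * u 0 - Real.sin (α ‖u‖) * u 1) - a * (Real.sin (α ‖u‖) * u 0 + Real.cos (α ‖u‖) * u 1)) / ‖u‖, (ϱ ‖u‖ * (Real.sin (α ‖u‖) * u 0 + Real.cos (α ‖u‖) * u 1) + a * (Real.cos (α ‖u‖) * u 0 - Real.sin (α ‖u‖) * u 1)) / ‖u‖, ϱ ‖u‖ * u 2 / ‖u‖]) → ∀ {u : E3}, u ≠ 0 → 0 < ϱ ‖u‖ → ∀ (t : ℝ), Kerr.radius a (E4.ofTimeSpace t (X u)) = ϱ ‖u‖ :=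
  fun hX _ hu hϱu t ↦ KerrCap.radius_capMap hX hu hϱu t

end Summit.FinalStateConjecture.FinalStateConjecture.Theorems.SwallowTheDatum

end
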